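import Summits.BirchSwinnertonDyer.BirchSwinnertonDyer.Theorems.KimAtThreeDeepLowerPortTorsionUpper
import HarnessLib

/-!
# Route `KimAtThreeKolyvagin` (rung W2): PORT@3-TORS-ALL as ONE ITEM TEXT in the route file's vocabulary, and the
# WHOLE ROUTE from it — cruxes 19075 / 19076 / 19077 / 19560, alias 19678, the LEAF `N11.KimAtThreeRankZeroPUB` and
# the DEEP statement `N11.KimAtThreeDeepPUB` BY NAME from the four PUBLISHED leaves + that one text

Cell `bsd-addord`, seat `bsd-addord-w2-c2` (gen 6; `--supports stmt-BirchSwinnertonDyer-19075`).  Sequel of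
`KimAtThreeDeepLowerPortTorsion` (p481375) / `…PortTorsionUpper`.
HONEST FRAMING. TOOL theorems only (no definition, no named fact, no `sorry`); nothing asserted about any curve,
nothing booked, no mark moved; every item named below stays OPEN (each theorem concludes a route decl UNDER
HYPOTHESES); BSD is not proved by any of this.  CONDITIONAL on the route's four published leaves
(`SakamotoKolyvaginThree` 19558, `RankEqAnalyticRankLeOne` 19921, `PoitouTateSelmerDuality` 19559,
`CarayolLevelEqConductor` 19467) and ONE displayed hypothesis `hTors` = the item text PORT@3-TORS-ALL (FLAG
`K22-Thm3.13-PORT@3`, the cell's one W2 debt class; NOT in print at `3`).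

WHAT.  PORT@3-TORS-ALL in ROUTE-FILE vocabulary (n1011's ONE-exponent witness clauses
`GaloisImage.KatoKuriharaWitnessAt W₀ k t Dk v₃ P` with the `t`-slot `t`, pinned guards `k k` / `k′ k′`, two
depths + (COMP); text = w2-c4 g7's PORT-ALL-SIGNATURE-g7.txt c0dc29d83e000985 with `#E(ℚ₃)[3] = 1` ↦
`∀ t, #E(ℚ₃)[3] = 3^t →` and `t`-slot `0` ↦ `t`; HOME/w2c2/PORT-TORS-ALL-SIGNATURE-g6.txt; kernel-checked to
elaborate in `namespace …Theses.KimAtThreeKolyvagin` with the route file as only import).  It SUBSUMES w2-c4's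
PORT@3-ALL (its `t = 0` instance, `3^0 = 1`) and implies the prequel's two-exponent `∃ e` form at `e = 0`
(`KimAtThreeKolyvaginDefs.katoKuriharaWitnessAtTwoExp_zero_of_witnessAt`; conversely the `∃ e` form gives the
one-exponent form by scaling Kato's families by `3^e`, acc6's `katoKuriharaWitnessAt_smul_of_witnessAtTwoExp` — the
two are inter-derivable as hypotheses, w2-c4 g7 memo §2).  THIS FILE lands the bridge `portTorsAll_of_portTorsAllWitnessAt` (item text ⟹ the prequels' two-exponent
`∃ e` consumer currency); from it + the four leaves, cruxes 19075 / 19076 / 19560, alias 19678, crux 19077, the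
LEAF `N11.KimAtThreeRankZeroPUB` and the DEEP statement `N11.KimAtThreeDeepPUB` follow BY NAME as ONE-LINE
compositions with the prequels' and w2-c4 g7's theorems (listed at the end of the file; kernel-checked in the
seat's sketch, not restated — gate dedup).  So ONE first-layer item with this text would carry the route's leaf,
its deep statement AND all three parent cruxes at every row (planner's (α) upgrade; director word needed).
References: [Kim2022StructureSelmer] Thm. 1.9 (6), Thm. 3.13; [Kim2025RefinedTNC] Thm 1.1/1.2; [Sakamoto2024]
Thm. 4.4; [MazurRubin2004] Thm. 3.2.4, 4.4.1, 5.2.12, App. A (33); [Kato2004Asterisque] Thm. 12.5 (1); [Carayol1986].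
-/

set_option autoImplicit false
-- the Theorems namespace of a single-conjunct summit repeats the summit name by design (D-0017)
set_option linter.dupNamespace false

noncomputable section

open scoped Classical NumberField ContRepresentation
open Function Field NumberField IsDedekindDomain IsDedekindDomain.HeightOneSpectrum WeierstrassCurve
  CongruenceSubgroup
  Literature.NumberTheory.EllipticCurves Literature.NumberTheory.EllipticCurves.ModularForms
  Literature.NumberTheory.EllipticCurves.Rank1Residual
  Literature.NumberTheory.GaloisRepresentations
  Literature.NumberTheory.GaloisRepresentations.DiscreteGaloisModule Literature.NumberTheory.GaloisCohomology
  Rat.HeightOneSpectrum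
  Summit.BirchSwinnertonDyer.Rank1Residual.GaloisImage
  Summit.BirchSwinnertonDyer.Rank1Residual.GaloisImage.Assembly
  Summit.BirchSwinnertonDyer.Rank1Residual.X4

namespace Summit.BirchSwinnertonDyer.BirchSwinnertonDyer.Theorems.KimAtThreeDeepLowerPortTorsionItem

open Summit.BirchSwinnertonDyer.Rank1Residual.Additive
  Summit.BirchSwinnertonDyer.BirchSwinnertonDyer.Theses.KimAtThreeKolyvagin
  Summit.BirchSwinnertonDyer.BirchSwinnertonDyer.Theorems.KimAtThreeKolyvaginDefs
  Summit.BirchSwinnertonDyer.BirchSwinnertonDyer.Theorems.KimAtThreeKolyvaginInputs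
  Summit.BirchSwinnertonDyer.BirchSwinnertonDyer.Theorems.KimAtThreeShallowEqDeepPortSeam
  Summit.BirchSwinnertonDyer.BirchSwinnertonDyer.Theorems.KimAtThreeShallowEqDeepPortItem
  Summit.BirchSwinnertonDyer.BirchSwinnertonDyer.Theorems.KimAtThreeDeepLowerPortTorsion
  Summit.BirchSwinnertonDyer.BirchSwinnertonDyer.Theorems.KimAtThreeDeepLowerPortTorsionUpper

section Item

/- PORT@3-TORS-ALL, route-file vocabulary (HOME/w2c2/PORT-TORS-ALL-SIGNATURE-g6.txt verbatim). -/
variable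
  (hTors : ∀ (W₀ : WeierstrassCurve ℚ) [W₀.IsElliptic] [W₀.IsGloballyMinimal],
      (∀ n : ℕ, W₀.HasSurjectiveModNGaloisRep (3 ^ n : ℕ)) →
      ∀ (t : ℕ), Nat.card {Q : (W₀.baseChange ℚ_[3]).toAffine.Point // (3 : ℕ) • Q = 0} = 3 ^ t →
      ∀ (v₃ : IsDedekindDomain.HeightOneSpectrum (NumberField.RingOfIntegers ℚ)),
        ((3 : ℕ) : NumberField.RingOfIntegers ℚ) ∈ v₃.asIdeal →
      ∀ (η : (q : IsDedekindDomain.HeightOneSpectrum (NumberField.RingOfIntegers ℚ)) →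
          (ZMod (Ideal.absNorm q.asIdeal))ˣ), (∀ q, Subgroup.zpowers (η q) = ⊤) →
      ∀ {N : ℕ} [NeZero N] (P : Literature.NumberTheory.EllipticCurves.ModularForms.ModularParametrizationData W₀ N),
        N = W₀.conductorNorm ℤ →
        (∀ z ∈ P.L.lattice, ∃ w ∈ Literature.NumberTheory.EllipticCurves.ModularForms.periodLattice P.f,
          z = P.c * w) →
        ∀ (k k' : ℕ)
          (Dk : Literature.NumberTheory.GaloisCohomology.KolyvaginDatum
            (W₀.torsionGaloisModule (((3 : ℕ) : ℤ) ^ k * ((3 : ℕ) : ℤ))))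
          (Dk' : Literature.NumberTheory.GaloisCohomology.KolyvaginDatum
            (W₀.torsionGaloisModule (((3 : ℕ) : ℤ) ^ k' * ((3 : ℕ) : ℤ))))
          (red : ContIntertwiningMap (W₀.torsionGaloisModule (((3 : ℕ) : ℤ) ^ k' * ((3 : ℕ) : ℤ))).toContRepresentation
            (W₀.torsionGaloisModule (((3 : ℕ) : ℤ) ^ k * ((3 : ℕ) : ℤ))).toContRepresentation),
          Dk.IsCanonicalTauDatumThreeAtWith W₀ k k η → Dk'.IsCanonicalTauDatumThreeAtWith W₀ k' k' η → k ≤ k' →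
          (∀ x : W₀.geomTorsion (((3 : ℕ) : ℤ) ^ k' * ((3 : ℕ) : ℤ)),
            ((red x : W₀.geomTorsion (((3 : ℕ) : ℤ) ^ k * ((3 : ℕ) : ℤ))) : W₀.geomPoints) =
              (((3 : ℕ) : ℤ) ^ (k' - k)) • (x : W₀.geomPoints)) →
          ∃ κ Λ κ' κu Λu κu',
            Summit.BirchSwinnertonDyer.Rank1Residual.GaloisImage.KatoKuriharaWitnessAt W₀ k t Dk v₃ P κ Λ κ' ∧
            Summit.BirchSwinnertonDyer.Rank1Residual.GaloisImage.KatoKuriharaWitnessAt W₀ k' t Dk' v₃ P κu Λu κu' ∧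
            ∀ d, Dk'.IsLevel d → Dk.IsLevel d →
              Literature.NumberTheory.GaloisRepresentations.galoisCohomology.map red 1 (κu d) = κ d ∧
              Literature.NumberTheory.GaloisRepresentations.galoisCohomology.map red 1 (κu' d) = κ' d)

include hTors

/-- **The item text gives the prequel's two-exponent `∃ e` port PORT@3-TORS-ALL** (take `e = 0`: n1011's
one-exponent witness clauses ARE the two-exponent ones at `e = 0`, `katoKuriharaWitnessAtTwoExp_zero_of_witnessAt`,
general `t`). [cite: Kim2022StructureSelmer, Thm. 3.13 (arXiv p. 17)] [cite: Kato2004Asterisque, Thm. 12.5 (1)] -/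
theorem portTorsAll_of_portTorsAllWitnessAt :
    ∀ (W₀ : WeierstrassCurve ℚ) [W₀.IsElliptic] [W₀.IsGloballyMinimal],
      (∀ n : ℕ, W₀.HasSurjectiveModNGaloisRep (3 ^ n : ℕ)) →
      ∀ (t : ℕ), Nat.card {Q : (W₀.baseChange ℚ_[3]).toAffine.Point // (3 : ℕ) • Q = 0} = 3 ^ t →
      ∀ (v₃ : HeightOneSpectrum (𝓞 ℚ)), ((3 : ℕ) : 𝓞 ℚ) ∈ v₃.asIdeal →
      ∀ (η : (q : HeightOneSpectrum (𝓞 ℚ)) → (ZMod (Ideal.absNorm q.asIdeal))ˣ),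
        (∀ q, Subgroup.zpowers (η q) = ⊤) →
      ∀ {N : ℕ} [NeZero N] (P : ModularParametrizationData W₀ N), N = W₀.conductorNorm ℤ →
        (∀ z ∈ P.L.lattice, ∃ w ∈ periodLattice P.f, z = P.c * w) →
        ∃ e : ℕ, ∀ (k k' : ℕ)
          (Dk : KolyvaginDatum (W₀.torsionGaloisModule (((3 : ℕ) : ℤ) ^ k * ((3 : ℕ) : ℤ))))
          (Dk' : KolyvaginDatum (W₀.torsionGaloisModule (((3 : ℕ) : ℤ) ^ k' * ((3 : ℕ) : ℤ))))
          (red : (W₀.torsionGaloisModule (((3 : ℕ) : ℤ) ^ k' * ((3 : ℕ) : ℤ))).toContRepresentation →ⁱL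
            (W₀.torsionGaloisModule (((3 : ℕ) : ℤ) ^ k * ((3 : ℕ) : ℤ))).toContRepresentation),
          Dk.IsCanonicalTauDatumThreeAtWith W₀ k k η → Dk'.IsCanonicalTauDatumThreeAtWith W₀ k' k' η →
          k ≤ k' →
          (∀ x : geomTorsion W₀ (((3 : ℕ) : ℤ) ^ k' * ((3 : ℕ) : ℤ)),
            ((red x : geomTorsion W₀ (((3 : ℕ) : ℤ) ^ k * ((3 : ℕ) : ℤ))) : geomPoints W₀) =
              (((3 : ℕ) : ℤ) ^ (k' - k)) • (x : geomPoints W₀)) →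
          ∃ κ Λ κ' κu Λu κu',
            KatoKuriharaWitnessAtTwoExp W₀ k t e Dk v₃ P κ Λ κ' ∧
            KatoKuriharaWitnessAtTwoExp W₀ k' t e Dk' v₃ P κu Λu κu' ∧
            ∀ d, Dk'.IsLevel d → Dk.IsLevel d →
              galoisCohomology.map red 1 (κu d) = κ d ∧ galoisCohomology.map red 1 (κu' d) = κ' d := by
  intro W₀ _ _ htow t ht v₃ hv₃ η hη N _ P hN hopt
  refine ⟨0, fun k k' Dk Dk' red hDk hDk' hk hred => ?_⟩
  obtain ⟨κ, Λ, κ', κu, Λu, κu', hW, hW', hcomp⟩ := hTors W₀ htow t ht v₃ hv₃ η hη P hN hopt k k' Dk Dk' red hDk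
    hDk' hk hred
  exact ⟨κ, Λ, κ', κu, Λu, κu', katoKuriharaWitnessAtTwoExp_zero_of_witnessAt hW,
    katoKuriharaWitnessAtTwoExp_zero_of_witnessAt hW', hcomp⟩

/- ONE-LINE COMPOSITIONS (kernel-checked in the seat's sketch HOME/w2c2/lean-g6/Sketch_W2_closes_portTors.lean,
rc 0; NOT restated as theorems here — the gate's dedup identifies them with the prequels' / w2-c4 g7's theorems,
of which they are instances):
* crux 19075: `KimAtThreeDeepLowerPortTorsion.deepLowerAtThree_of_pub_of_portTorsAll
    (portTorsAll_of_portTorsAllWitnessAt hTors) hSak hGZK hPT hlev : DeepLowerAtThree`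
* crux 19076: `KimAtThreeDeepLowerPortTorsionUpper.deepUpperAtThree_of_pub_of_portTorsAll
    (portTorsAll_of_portTorsAllWitnessAt hTors) hSak hGZK hPT hlev : DeepUpperAtThree`
* DEEP statement: `KimAtThreeDeepLowerPortTorsionUpper.kimAtThreeDeepPUB_of_pub_of_portTorsAll
    (portTorsAll_of_portTorsAllWitnessAt hTors) hSak hGZK hPT hlev : N11.KimAtThreeDeepPUB`
* crux 19560: `KimAtThreeShallowEqDeepPortItem.katoKuriharaPortThreeShared_of_portAll
    (fun W₀ _ _ htow ht v₃ hv₃ η hη _ _ P hN hopt => hTors W₀ htow 0 (by simpa using ht) v₃ hv₃ η hη P hN hopt)`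
* alias 19678 / crux 19077 / the LEAF `N11.KimAtThreeRankZeroPUB`: w2-c4 g7's
  `katoStratumSharedParts_of_pub_of_portAll` / `shallowEqDeepAtTorsionFree_of_pub_of_portAll` /
  `kimAtThreeRankZeroPUB_of_pub_of_portAll` on the same `t = 0` instance, then `hSak hGZK hPT hlev`. -/

end Item


/-! ### Appendix (w2-c2 gen 6, append): PORT@3-TORS-OFF as an item text for crux 19679 alone -/

section ItemOff

/- PORT@3-TORS-OFF, route-file vocabulary (HOME/w2c2/PORT-TORS-OFF-SIGNATURE-g6.txt verbatim): the same clauses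
asked only OFF the Kato stratum (antecedent = crux 19679's `¬ (Addv ∧ 3 ∤ c₃ ∧ #E(ℚ₃)[3] = 1 ∧ 3 ∤ c_P)`). -/
variable
  (hTorsOff : ∀ (W₀ : WeierstrassCurve ℚ) [W₀.IsElliptic] [W₀.IsGloballyMinimal],
      (∀ n : ℕ, W₀.HasSurjectiveModNGaloisRep (3 ^ n : ℕ)) →
      ∀ (t : ℕ), Nat.card {Q : (W₀.baseChange ℚ_[3]).toAffine.Point // (3 : ℕ) • Q = 0} = 3 ^ t →
      ∀ (v₃ : IsDedekindDomain.HeightOneSpectrum (NumberField.RingOfIntegers ℚ)),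
        ((3 : ℕ) : NumberField.RingOfIntegers ℚ) ∈ v₃.asIdeal →
      ∀ (η : (q : IsDedekindDomain.HeightOneSpectrum (NumberField.RingOfIntegers ℚ)) →
          (ZMod (Ideal.absNorm q.asIdeal))ˣ), (∀ q, Subgroup.zpowers (η q) = ⊤) →
      ∀ {N : ℕ} [NeZero N] (P : Literature.NumberTheory.EllipticCurves.ModularForms.ModularParametrizationData W₀ N),
        N = W₀.conductorNorm ℤ →
        (∀ z ∈ P.L.lattice, ∃ w ∈ Literature.NumberTheory.EllipticCurves.ModularForms.periodLattice P.f,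
          z = P.c * w) →
        ¬ ((haveI : Fact (Nat.Prime 3) := ⟨Nat.prime_three⟩;
              Literature.NumberTheory.EllipticCurves.Rank1Residual.Addv W₀ 3) ∧
            ¬ 3 ∣ (W₀.baseChange ℚ_[3]).localTamagawaNumber ℤ_[3] ∧
            Nat.card {Q : (W₀.baseChange ℚ_[3]).toAffine.Point // (3 : ℕ) • Q = 0} = 1 ∧
            ¬ (3 : ℤ) ∣ P.maninConstant) →
        ∀ (k k' : ℕ)
          (Dk : Literature.NumberTheory.GaloisCohomology.KolyvaginDatum
            (W₀.torsionGaloisModule (((3 : ℕ) : ℤ) ^ k * ((3 : ℕ) : ℤ))))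
          (Dk' : Literature.NumberTheory.GaloisCohomology.KolyvaginDatum
            (W₀.torsionGaloisModule (((3 : ℕ) : ℤ) ^ k' * ((3 : ℕ) : ℤ))))
          (red : ContIntertwiningMap (W₀.torsionGaloisModule (((3 : ℕ) : ℤ) ^ k' * ((3 : ℕ) : ℤ))).toContRepresentation
            (W₀.torsionGaloisModule (((3 : ℕ) : ℤ) ^ k * ((3 : ℕ) : ℤ))).toContRepresentation),
          Dk.IsCanonicalTauDatumThreeAtWith W₀ k k η → Dk'.IsCanonicalTauDatumThreeAtWith W₀ k' k' η → k ≤ k' →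
          (∀ x : W₀.geomTorsion (((3 : ℕ) : ℤ) ^ k' * ((3 : ℕ) : ℤ)),
            ((red x : W₀.geomTorsion (((3 : ℕ) : ℤ) ^ k * ((3 : ℕ) : ℤ))) : W₀.geomPoints) =
              (((3 : ℕ) : ℤ) ^ (k' - k)) • (x : W₀.geomPoints)) →
          ∃ κ Λ κ' κu Λu κu',
            Summit.BirchSwinnertonDyer.Rank1Residual.GaloisImage.KatoKuriharaWitnessAt W₀ k t Dk v₃ P κ Λ κ' ∧
            Summit.BirchSwinnertonDyer.Rank1Residual.GaloisImage.KatoKuriharaWitnessAt W₀ k' t Dk' v₃ P κu Λu κu' ∧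
            ∀ d, Dk'.IsLevel d → Dk.IsLevel d →
              Literature.NumberTheory.GaloisRepresentations.galoisCohomology.map red 1 (κu d) = κ d ∧
              Literature.NumberTheory.GaloisRepresentations.galoisCohomology.map red 1 (κu' d) = κ' d)

include hTorsOff

/-- **The OFF item text gives the prequel's two-exponent `∃ e` port PORT@3-TORS-OFF** (`e = 0`,
`katoKuriharaWitnessAtTwoExp_zero_of_witnessAt`), i.e. the hypothesis `hPortTorsOff` of
`KimAtThreeDeepLowerPortTorsion.deepLowerAtThreeOffKatoStratum_of_portTorsOff` (crux 19679 BY NAME then reads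
`… (portTorsOff_of_portTorsOffWitnessAt hTorsOff) hS24 hS24₂ hGZK hPT`, a one-line composition, not restated) and of
`KimAtThreeDeepLowerPortTorsionUpper.deepUpperAtThreeOffKatoStratum_of_portTorsOff` (crux 19562).
[cite: Kim2022StructureSelmer, Thm. 3.13 (arXiv p. 17)] [cite: Kato2004Asterisque, Thm. 12.5 (1)] -/
theorem portTorsOff_of_portTorsOffWitnessAt :
    ∀ (W₀ : WeierstrassCurve ℚ) [W₀.IsElliptic] [W₀.IsGloballyMinimal],
      (∀ n : ℕ, W₀.HasSurjectiveModNGaloisRep (3 ^ n : ℕ)) →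
      ∀ (t : ℕ), Nat.card {Q : (W₀.baseChange ℚ_[3]).toAffine.Point // (3 : ℕ) • Q = 0} = 3 ^ t →
      ∀ (v₃ : HeightOneSpectrum (𝓞 ℚ)), ((3 : ℕ) : 𝓞 ℚ) ∈ v₃.asIdeal →
      ∀ (η : (q : HeightOneSpectrum (𝓞 ℚ)) → (ZMod (Ideal.absNorm q.asIdeal))ˣ),
        (∀ q, Subgroup.zpowers (η q) = ⊤) →
      ∀ {N : ℕ} [NeZero N] (P : ModularParametrizationData W₀ N), N = W₀.conductorNorm ℤ →
        (∀ z ∈ P.L.lattice, ∃ w ∈ periodLattice P.f, z = P.c * w) →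
        ¬ ((haveI : Fact (Nat.Prime 3) := ⟨Nat.prime_three⟩; Addv W₀ 3) ∧
            ¬ 3 ∣ (W₀.baseChange ℚ_[3]).localTamagawaNumber ℤ_[3] ∧
            Nat.card {Q : (W₀.baseChange ℚ_[3]).toAffine.Point // (3 : ℕ) • Q = 0} = 1 ∧
            ¬ (3 : ℤ) ∣ P.maninConstant) →
        ∃ e : ℕ, ∀ (k k' : ℕ)
          (Dk : KolyvaginDatum (W₀.torsionGaloisModule (((3 : ℕ) : ℤ) ^ k * ((3 : ℕ) : ℤ))))
          (Dk' : KolyvaginDatum (W₀.torsionGaloisModule (((3 : ℕ) : ℤ) ^ k' * ((3 : ℕ) : ℤ))))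
          (red : (W₀.torsionGaloisModule (((3 : ℕ) : ℤ) ^ k' * ((3 : ℕ) : ℤ))).toContRepresentation →ⁱL
            (W₀.torsionGaloisModule (((3 : ℕ) : ℤ) ^ k * ((3 : ℕ) : ℤ))).toContRepresentation),
          Dk.IsCanonicalTauDatumThreeAtWith W₀ k k η → Dk'.IsCanonicalTauDatumThreeAtWith W₀ k' k' η →
          k ≤ k' →
          (∀ x : geomTorsion W₀ (((3 : ℕ) : ℤ) ^ k' * ((3 : ℕ) : ℤ)),
            ((red x : geomTorsion W₀ (((3 : ℕ) : ℤ) ^ k * ((3 : ℕ) : ℤ))) : geomPoints W₀) =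
              (((3 : ℕ) : ℤ) ^ (k' - k)) • (x : geomPoints W₀)) →
          ∃ κ Λ κ' κu Λu κu',
            KatoKuriharaWitnessAtTwoExp W₀ k t e Dk v₃ P κ Λ κ' ∧
            KatoKuriharaWitnessAtTwoExp W₀ k' t e Dk' v₃ P κu Λu κu' ∧
            ∀ d, Dk'.IsLevel d → Dk.IsLevel d →
              galoisCohomology.map red 1 (κu d) = κ d ∧ galoisCohomology.map red 1 (κu' d) = κ' d := by
  intro W₀ _ _ htow t ht v₃ hv₃ η hη N _ P hN hopt hoff
  refine ⟨0, fun k k' Dk Dk' red hDk hDk' hk hred => ?_⟩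
  obtain ⟨κ, Λ, κ', κu, Λu, κu', hW, hW', hcomp⟩ := hTorsOff W₀ htow t ht v₃ hv₃ η hη P hN hopt hoff k k' Dk Dk'
    red hDk hDk' hk hred
  exact ⟨κ, Λ, κ', κu, Λu, κu', katoKuriharaWitnessAtTwoExp_zero_of_witnessAt hW,
    katoKuriharaWitnessAtTwoExp_zero_of_witnessAt hW', hcomp⟩

end ItemOff

end Summit.BirchSwinnertonDyer.BirchSwinnertonDyer.Theorems.KimAtThreeDeepLowerPortTorsionItem

end

/-! ## ERRATUM (w2-c2 gen 6, 2026-08-27T02:45Z, append-only; no declaration changed)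

The module docstring's sentence «the faithful `p = 3` port on a `t`-row is w2-c4's unlocked text with the
`t`-slot `t` (guards `k k` / `k′ k′`: PINNED classes)» and the reading «n1011's (B6) guards `k + t` / acc1's depth
shift 2 are DISCHARGER conveniences, not part of the printed law» are WITHDRAWN.  [MR04] App. A, Prop. A.2
(pp. 79–80): when `H⁰(ℚ_p, T*)` is not divisible — for `T₃E`: `E(ℚ₃)[3] ≠ 0`, i.e. `t ≥ 1` — the derivative
classes `κ_n^{(k)}` satisfy the CANONICAL local condition at `p` only for `n ∈ 𝒩_j` with `j` beyond the stable
range («`𝓕(ℚ_p, T/m^k)` is the image of `H¹(ℚ_p, T/m^j)` for `j ≫ 0`; for `n ∈ 𝒩_j`, `I_n ⊂ m^j`»); the tree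
has it with the level explicit (n1011 T-DER-BP, `PropagatedConditionStableRangeThree`:
`im red_N = 𝓕_can(E[3^{k+1}])₃` iff `N ≥ N₀`, the torsion-stable level of `E(ℚ₃)`), and Kim AJM 148 Thm. 3.13 is
stated on `Sel_{rel,n}` (relaxed at `p`, extended `exp*` of §3.3.2) for the same reason.  So at `t ≥ 1` clause (0)
of `KatoKuriharaWitnessAt[TwoExp]` (Selmer membership for `𝓕_can` PROPAGATED at `3`) is supported by print ONLY
on data whose primes lie in the class of depth `k + N₀` — the DEEP guards of n1011's PORT″ / acc6's PORT₂ — and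
the pinned-guard `t`-slot-`t` port hypothesis of this file (`hPort` of §1–§2 at `t ≥ 1`, `hPortTorsOff` /
`hPortTorsAll` at `t ≥ 1`) OVER-ASKS: it is not known to follow from Kato's Euler system, may fail on rows where
some pinned level's class does not lift at `3`, and must NOT be registered as an item text.  Every theorem here
remains a valid kernel statement; at `t = 0` (`#E(ℚ₃)[3] = 1`, `N₀ = 0`) the hypothesis IS w2-c4 g7's PORT@3-OFF
/ -ALL and nothing changes.  The `t ≥ 1` rows' road of record stays acc3's (R₁)
(`KimAtThreeDeepLowerOffStratumAdditiveDefectTorsionSplit.torsionRows_of_deepPortsTwoExp`: deep-guard PORT₂ +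
S24-DEEP (1)(2)) until the flag-free deep END (`KimAtThreeDeepLowerS24DeepOfPinned` re-key + one port-free good
core vertex per class depth) lands.  [cite: MazurRubin2004, App. A, Lemma A.1 and Prop. A.2 (pp. 79–80)]
[cite: Kim2022StructureSelmer, §3.3.2 and Thm. 3.13 (arXiv p. 17)] -/
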